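import Summits.KontsevichZagierPeriods.Zeta5Search.RecordLettersF55R1
import Summits.KontsevichZagierPeriods.Zeta5Search.ClassTypeGuardsI
import HarnessLib

/-!
# ζ(5) search — record-ray LETTERS window F91 = `(30/19, 19/12)`: `v_p(Cas₇(b(n))) ≥ -62` BY NAME via law A3 (p3 g6)

HONEST FRAMING: systematic search; no irrationality claim unless certified.  Cell `pub-zeta5`, prover seat p3, generation 6.
The law-A3 UPGRADE of window F55 (`RecordLetters.F55.window`: `−63` by the double-drop bonus): the SAME parity covers
`RecordLetters.F55.R0.cover` / `R1.cover` checked against `ClassTypeGuardsI.checkI` (`M = 34`, deep type the palindrome below) give,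
through `record_I` (`SecondOrder.lawA3_holds`), **`-62 ≤ v_p(Cas₇(b(n)))` for every `n ≥ 64` and every prime with `30·n < 19·p`,
`12·p < 19·n`, `41n + 2 < p²`** — the census by-name LETTERS value (window (41/26,19/12], letters P1B1I1).  Valuations of rationals;
every kernel exponent these feed stays `< 1` — no irrationality content.
-/

open Finset

namespace Summit.KontsevichZagierPeriods.Zeta5Search.RecordLetters.F91

open Summit.KontsevichZagierPeriods.Zeta5Search.ClusterValuation
open Summit.KontsevichZagierPeriods.Zeta5Search.CasoratianValuation (casoratian)
open Summit.KontsevichZagierPeriods.Zeta5Search.ClassTypeCover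

/-- **Window F91**: `-62 ≤ v_p(Cas₇(b(n)))` for `n ≥ 64`, `p` prime, `30·n < 19·p`, `12·p < 19·n`, `41n + 2 < p²`. -/
theorem window (n p : ℕ) (hn : 64 ≤ n) (hp : p.Prime) (hA : 30 * n < 19 * p) (hB : 12 * p < 19 * n)
    (hsq : 41 * n + 2 < p ^ 2) (hne : casoratian (bRec n) 7 ≠ 0) : (-62 : ℤ) ≤ padicValRat p (casoratian (bRec n) 7) := by
  haveI := Fact.mk hp
  have hp2 : p % 2 = 1 := Nat.odd_iff.1 (hp.odd_of_ne_two (by omega))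
  have hp5 : 5 ≤ p := by omega
  have hpd : p ≤ 25 * n := by omega
  have hn1 : 1 ≤ n := by omega
  rcases Nat.mod_two_eq_zero_or_one n with hr | hr
  · exact record_I hn1 hp hp5 hpd hsq hr (RecordLetters.F55.R0.cover (by omega) hr hp2 hA hB) (M := 34) (by norm_num) (by decide)
      (T := [1, 1, 1, 1, 1, 1, 0, -1, -3, -4, -6, -6, -6, -6, -6, -4, -3, -1, 0, 1, 1, 1, 1, 1, 1]) (by decide) (by decide +kernel) (c := -62) (by norm_num) hne
  · exact record_I hn1 hp hp5 hpd hsq hr (RecordLetters.F55.R1.cover (by omega) hr hp2 hA hB) (M := 34) (by norm_num) (by decide)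
      (T := [1, 1, 1, 1, 1, 1, 0, -1, -3, -4, -6, -6, -6, -6, -6, -4, -3, -1, 0, 1, 1, 1, 1, 1, 1]) (by decide) (by decide +kernel) (c := -62) (by norm_num) hne

end Summit.KontsevichZagierPeriods.Zeta5Search.RecordLetters.F91
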